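import Mathlib
import HarnessLib
import Summits.ValiantsHypothesis.ValiantsHypothesis.Theorems.LacunarySymmetroidMatrixDescartesProductPlusOneBalanceCount
import Summits.ValiantsHypothesis.ValiantsHypothesis.Theorems.LacunarySymmetroidMatrixDescartesProductPlusOneRiccatiLevels

/-!
# ValiantsHypothesis / LacunarySymmetroid — crux `MatrixDescartes` (stmt-ValiantsHypothesis-18050, V1),
# LINE (A) «product_plus_one», floor `OneChangeFloorK3`: the FEW-PULLERS LAW — mixed-phase windows at EVERY support ratio

First kernel law INSIDE the floor's open core («risers against pullers», ✓ `…Riccati`; the window laws of ✓ `…UnswitchedWindow` …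
✓ `…ExactZone` need every incoherent row monotone).  Pure INCOHERENT company (`a_j b_j < 0`, `a_j c_j < 0`: the `(+,−,−)` rows of the floor,
any signs), `K = 3`, bottom coupling, `p = e+1`, `q = e+k+2`, `Ψ = Σ_j Ψ_j`, `Ψ_j = (p b_j + q c_j x^{q−p})/g_j`.  Two exact identities
(✓ `psi_numerator_eq`):

  `Ψ′ = q(q−p)·x^{q−p−1}·A₂ − x^{p−1}·Σ_j Ψ_j²`,  `A₂ = Σ_j c_j/g_j`  (the letter-partial sum of ✓ `…ABWindow`),

and, at a point where `Ψ = 0`, with `R` = switched rows (risers, `Ψ_j > 0`, `x^pΨ_j > p`, `c_j/g_j ≤ Ψ_j/(q x^{q−p})`) and `U` = unswitched rows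
(pullers, `Ψ_j < 0`, `c_j/g_j < 0`), `M = Σ_R Ψ_j = Σ_U |Ψ_j|`: Cauchy–Schwarz gives `Σ_j Ψ_j² ≥ M²(1/|R| + 1/|U|)` and `A₂ ≤ M/(q x^{q−p})`, so

  `|R||U|·x·Ψ′ ≤ M·(|R||U|(q−p) − m·x^p M) < M·|R|·((q−p)|U| − p·m)`.

* ★★ `psi_deriv_neg_at_zero_of_fewPullers` — if `(q−p)·|U| ≤ p·m` (at most `m/(r−1)` pullers, `r = q/p`) then every zero of `Ψ` is a STRICT
  DOWN-CROSSING;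
* ★★ `euler_window_roots_le_one_of_fewPullers` — hence (✓ `no_two_zeros_of_deriv_neg_at_zeros`) on a zero-free window `[u,v] ⊂ (0,∞)` of a pure
  incoherent company on ANY support `d 0 < d 1 < d 2` with at most `m·(d₁−d₀)/(d₂−d₁)` rows unswitched, `eulerNumerator d a 0` has AT MOST ONE
  root — whatever the balance-zone positions of the risers (young risers allowed);
* ★★ `euler_roots_late_le_of_fewPullers` — the unswitched set only shrinks as `x` grows, so if at `U₀ > 0` at most `m(d₁−d₀)/(d₂−d₁)` rows are
  unswitched then `#{roots of eulerNumerator d a 0 in [U₀,∞)} ≤ 2m + 1`: the LAST `⌊m/(r−1)⌋` GAPS of a pure incoherent company are tame at every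
  ratio (at ratio `≤ 2` every gap: the whole company is linear, inside the tame sector's `≤ 4`).

HONEST FRAMING: a cell of the research floor (pure incoherent companies, late windows); NOT `OneChangeFloorK3` / `stub_eulerBoundK3` /
`stub_classRowK3` / `stub_polyLaw` / `MatrixDescartes`; `VP ≠ VNP` is NOT proved.  No definitions, no named facts; Mathlib + lane files.
-/

set_option linter.dupNamespace false

namespace Summit.ValiantsHypothesis.ValiantsHypothesis.Theorems.LacunarySymmetroidMatrixDescartes

namespace ProductPlusOne

open Polynomial Finset
open scoped BigOperators

/-! ### §1 Pointwise algebra of one row -/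

/-- `num_j/g_j² = q(k+1)x^k·(c_j/g_j) − x^e·Ψ_j²` (✓ `psi_numerator_eq`, `g_j(x) ≠ 0`). [folklore] -/
theorem psi_term_deriv_eq (a b c : ℝ) (e k : ℕ) {x : ℝ} (hg : a + b * x ^ (e + 1) + c * x ^ (e + k + 2) ≠ 0) :
    (((e + k + 2 : ℝ) * c * ((k + 1 : ℝ) * x ^ k)) * (a + b * x ^ (e + 1) + c * x ^ (e + k + 2))
        - ((e + 1 : ℝ) * b + (e + k + 2 : ℝ) * c * x ^ (k + 1))
          * (b * ((e + 1 : ℝ) * x ^ e) + c * ((e + k + 2 : ℝ) * x ^ (e + k + 1))))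
        / (a + b * x ^ (e + 1) + c * x ^ (e + k + 2)) ^ 2
      = (e + k + 2 : ℝ) * (k + 1 : ℝ) * x ^ k * (c / (a + b * x ^ (e + 1) + c * x ^ (e + k + 2)))
        - x ^ e * (((e + 1 : ℝ) * b + (e + k + 2 : ℝ) * c * x ^ (k + 1)) / (a + b * x ^ (e + 1) + c * x ^ (e + k + 2))) ^ 2 := by
  rw [psi_numerator_eq]
  field_simp

/-- **Riser facts** (incoherent no-dip row, SWITCHED: `a·g(x) < 0`, `x > 0`): `Ψ_j > 0`, `c_j/g_j ≤ Ψ_j/(q·x^{k+1})`, and `x^{e+1}·Ψ_j > p`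
(the switched Euler ratio exceeds `p`, ✓ `eulerRatio_gt_of_switched`). [this file's lemma] -/
theorem riser_facts (a b c : ℝ) (e k : ℕ) {x : ℝ} (hx : 0 < x) (hab : a * b < 0) (hac : a * c < 0)
    (hsw : a * (a + b * x ^ (e + 1) + c * x ^ (e + k + 2)) < 0) :
    0 < ((e + 1 : ℝ) * b + (e + k + 2 : ℝ) * c * x ^ (k + 1)) / (a + b * x ^ (e + 1) + c * x ^ (e + k + 2)) ∧
    c / (a + b * x ^ (e + 1) + c * x ^ (e + k + 2))
      ≤ ((e + 1 : ℝ) * b + (e + k + 2 : ℝ) * c * x ^ (k + 1)) / (a + b * x ^ (e + 1) + c * x ^ (e + k + 2))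
        / ((e + k + 2 : ℝ) * x ^ (k + 1)) ∧
    (e + 1 : ℝ) < x ^ (e + 1) * (((e + 1 : ℝ) * b + (e + k + 2 : ℝ) * c * x ^ (k + 1)) / (a + b * x ^ (e + 1) + c * x ^ (e + k + 2))) := by
  set g := a + b * x ^ (e + 1) + c * x ^ (e + k + 2) with hgdef
  have hZ : 0 < x ^ (k + 1) := pow_pos hx _
  have hX : 0 < x ^ (e + 1) := pow_pos hx _
  have hq : (0 : ℝ) < (e + k + 2 : ℝ) := by positivity
  rcases lt_or_gt_of_ne (show a ≠ 0 by rintro rfl; rw [zero_mul] at hac; exact lt_irrefl 0 hac) with ha | ha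
  · -- a < 0 < b, c; g > 0
    have hb : 0 < b := by nlinarith
    have hc : 0 < c := by nlinarith
    have hg : 0 < g := by nlinarith
    have hN : 0 < (e + 1 : ℝ) * b + (e + k + 2 : ℝ) * c * x ^ (k + 1) := by positivity
    refine ⟨div_pos hN hg, ?_, ?_⟩
    · refine sub_nonneg.mp ?_
      have e1 : ((e + 1 : ℝ) * b + (e + k + 2 : ℝ) * c * x ^ (k + 1)) / g / ((e + k + 2 : ℝ) * x ^ (k + 1)) - c / g
          = (e + 1 : ℝ) * b / (g * ((e + k + 2 : ℝ) * x ^ (k + 1))) := by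
        field_simp
        ring
      rw [e1]
      exact (div_pos (by positivity) (mul_pos hg (mul_pos hq hZ))).le
    · rw [mul_div_assoc', lt_div_iff₀ hg]
      have : (e + 1 : ℝ) * g < x ^ (e + 1) * ((e + 1 : ℝ) * b + (e + k + 2 : ℝ) * c * x ^ (k + 1)) := by
        have e1 : x ^ (e + 1) * ((e + 1 : ℝ) * b + (e + k + 2 : ℝ) * c * x ^ (k + 1)) - (e + 1 : ℝ) * g
            = ((e + k + 2 : ℝ) - (e + 1 : ℝ)) * c * x ^ (e + k + 2) - (e + 1 : ℝ) * a := by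
          rw [hgdef]; ring
        have h2 : 0 < ((e + k + 2 : ℝ) - (e + 1 : ℝ)) * c * x ^ (e + k + 2) - (e + 1 : ℝ) * a := by
          have : 0 < ((e + k + 2 : ℝ) - (e + 1 : ℝ)) * c * x ^ (e + k + 2) := by
            have : (0 : ℝ) < (e + k + 2 : ℝ) - (e + 1 : ℝ) := by
              have : (0:ℝ) ≤ k := by positivity
              linarith
            positivity
          nlinarith
        linarith
      linarith
  · -- a > 0 > b, c; g < 0
    have hb : b < 0 := by nlinarith
    have hc : c < 0 := by nlinarith
    have hg : g < 0 := by nlinarith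
    have hN : (e + 1 : ℝ) * b + (e + k + 2 : ℝ) * c * x ^ (k + 1) < 0 := by
      have : (e + k + 2 : ℝ) * c * x ^ (k + 1) < 0 := mul_neg_of_neg_of_pos (mul_neg_of_pos_of_neg hq hc) hZ
      have : (e + 1 : ℝ) * b < 0 := mul_neg_of_pos_of_neg (by positivity) hb
      linarith
    refine ⟨div_pos_of_neg_of_neg hN hg, ?_, ?_⟩
    · refine sub_nonneg.mp ?_
      have e1 : ((e + 1 : ℝ) * b + (e + k + 2 : ℝ) * c * x ^ (k + 1)) / g / ((e + k + 2 : ℝ) * x ^ (k + 1)) - c / g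
          = (e + 1 : ℝ) * b / (g * ((e + k + 2 : ℝ) * x ^ (k + 1))) := by
        field_simp
        ring
      rw [e1]
      exact (div_pos_of_neg_of_neg (mul_neg_of_pos_of_neg (by positivity) hb)
        (mul_neg_of_neg_of_pos hg (mul_pos hq hZ))).le
    · rw [mul_div_assoc', lt_div_iff_of_neg hg]
      have e1 : x ^ (e + 1) * ((e + 1 : ℝ) * b + (e + k + 2 : ℝ) * c * x ^ (k + 1)) - (e + 1 : ℝ) * g
          = ((e + k + 2 : ℝ) - (e + 1 : ℝ)) * c * x ^ (e + k + 2) - (e + 1 : ℝ) * a := by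
        rw [hgdef]; ring
      have h2 : ((e + k + 2 : ℝ) - (e + 1 : ℝ)) * c * x ^ (e + k + 2) - (e + 1 : ℝ) * a < 0 := by
        have : ((e + k + 2 : ℝ) - (e + 1 : ℝ)) * c * x ^ (e + k + 2) < 0 := by
          have hqp : (0 : ℝ) < (e + k + 2 : ℝ) - (e + 1 : ℝ) := by
            have : (0:ℝ) ≤ k := by positivity
            linarith
          exact mul_neg_of_neg_of_pos (mul_neg_of_pos_of_neg hqp hc) (pow_pos hx _)
        nlinarith
      linarith

/-- **Puller facts** (incoherent no-dip row, UNSWITCHED: `a·g(x) > 0`, `x > 0`): `Ψ_j < 0` and `c_j/g_j < 0`. [this file's lemma] -/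
theorem puller_facts (a b c : ℝ) (e k : ℕ) {x : ℝ} (hx : 0 < x) (hab : a * b < 0) (hac : a * c < 0)
    (hun : 0 < a * (a + b * x ^ (e + 1) + c * x ^ (e + k + 2))) :
    ((e + 1 : ℝ) * b + (e + k + 2 : ℝ) * c * x ^ (k + 1)) / (a + b * x ^ (e + 1) + c * x ^ (e + k + 2)) < 0 ∧
    c / (a + b * x ^ (e + 1) + c * x ^ (e + k + 2)) < 0 := by
  set g := a + b * x ^ (e + 1) + c * x ^ (e + k + 2) with hgdef
  have hZ : 0 < x ^ (k + 1) := pow_pos hx _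
  have hq : (0 : ℝ) < (e + k + 2 : ℝ) := by positivity
  rcases lt_or_gt_of_ne (show a ≠ 0 by rintro rfl; rw [zero_mul] at hac; exact lt_irrefl 0 hac) with ha | ha
  · have hb : 0 < b := by nlinarith
    have hc : 0 < c := by nlinarith
    have hg : g < 0 := by nlinarith
    have hN : 0 < (e + 1 : ℝ) * b + (e + k + 2 : ℝ) * c * x ^ (k + 1) := by positivity
    exact ⟨div_neg_of_pos_of_neg hN hg, div_neg_of_pos_of_neg hc hg⟩
  · have hb : b < 0 := by nlinarith
    have hc : c < 0 := by nlinarith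
    have hg : 0 < g := by nlinarith
    have hN : (e + 1 : ℝ) * b + (e + k + 2 : ℝ) * c * x ^ (k + 1) < 0 := by
      have : (e + k + 2 : ℝ) * c * x ^ (k + 1) < 0 := mul_neg_of_neg_of_pos (mul_neg_of_pos_of_neg hq hc) hZ
      have : (e + 1 : ℝ) * b < 0 := mul_neg_of_pos_of_neg (by positivity) hb
      linarith
    exact ⟨div_neg_of_neg_of_pos hN hg, div_neg_of_neg_of_pos hc hg⟩

/-! ### §2 Every zero of `Ψ` is a strict down-crossing when the pullers are few -/

/-- ★★ **FEW PULLERS ⇒ DOWN-CROSSING.**  Pure incoherent no-dip company (`a_j b_j < 0`, `a_j c_j < 0`), `m ≥ 1`, `x > 0`, no row vanishing at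
`x`, `Ψ(x) = 0`, and `(k+1)·#{unswitched rows at x} ≤ (e+1)·m` (i.e. `(q−p)|U| ≤ p·m`).  Then `Ψ′(x) = Σ_j num_j/g_j² < 0`. [this file's theorem] -/
theorem psi_deriv_neg_at_zero_of_fewPullers {m : ℕ} (hm : 0 < m) (a b c : Fin m → ℝ) (e k : ℕ) {x : ℝ} (hx : 0 < x)
    (hg : ∀ j, a j + b j * x ^ (e + 1) + c j * x ^ (e + k + 2) ≠ 0)
    (hinc : ∀ j, a j * b j < 0 ∧ a j * c j < 0)
    (hfew : ((k : ℝ) + 1) * ((Finset.univ.filter (fun j => 0 < a j * (a j + b j * x ^ (e + 1) + c j * x ^ (e + k + 2)))).card : ℝ)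
      ≤ ((e : ℝ) + 1) * m)
    (hzero : (∑ j, ((e + 1 : ℝ) * b j + (e + k + 2 : ℝ) * c j * x ^ (k + 1)) / (a j + b j * x ^ (e + 1) + c j * x ^ (e + k + 2))) = 0) :
    (∑ j, ((((e + k + 2 : ℝ) * c j * ((k + 1 : ℝ) * x ^ k)) * (a j + b j * x ^ (e + 1) + c j * x ^ (e + k + 2))
        - ((e + 1 : ℝ) * b j + (e + k + 2 : ℝ) * c j * x ^ (k + 1))
          * (b j * ((e + 1 : ℝ) * x ^ e) + c j * ((e + k + 2 : ℝ) * x ^ (e + k + 1))))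
        / (a j + b j * x ^ (e + 1) + c j * x ^ (e + k + 2)) ^ 2)) < 0 := by
  classical
  -- notation
  set G : Fin m → ℝ := fun j => a j + b j * x ^ (e + 1) + c j * x ^ (e + k + 2) with hG
  set ψ : Fin m → ℝ := fun j => ((e + 1 : ℝ) * b j + (e + k + 2 : ℝ) * c j * x ^ (k + 1)) / G j with hψ
  set U := Finset.univ.filter (fun j => 0 < a j * G j) with hU
  set R := Finset.univ.filter (fun j => ¬ 0 < a j * G j) with hR
  have hZ : 0 < x ^ (k + 1) := pow_pos hx _
  have hX : 0 < x ^ (e + 1) := pow_pos hx _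
  have hq : (0 : ℝ) < (e + k + 2 : ℝ) := by positivity
  -- rows in `R` are switched
  have hRsw : ∀ j ∈ R, a j * G j < 0 := by
    intro j hj
    rw [hR, mem_filter] at hj
    have hne : a j * G j ≠ 0 := mul_ne_zero (by
      intro h0; have := (hinc j).2; rw [h0, zero_mul] at this; exact lt_irrefl 0 this) (hg j)
    exact lt_of_le_of_ne (not_lt.mp hj.2) hne
  have hUun : ∀ j ∈ U, 0 < a j * G j := fun j hj => by rw [hU, mem_filter] at hj; exact hj.2
  -- per-row facts
  have hRfacts : ∀ j ∈ R, 0 < ψ j ∧ c j / G j ≤ ψ j / ((e + k + 2 : ℝ) * x ^ (k + 1)) ∧ (e + 1 : ℝ) < x ^ (e + 1) * ψ j :=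
    fun j hj => riser_facts (a j) (b j) (c j) e k hx (hinc j).1 (hinc j).2 (hRsw j hj)
  have hUfacts : ∀ j ∈ U, ψ j < 0 ∧ c j / G j < 0 :=
    fun j hj => puller_facts (a j) (b j) (c j) e k hx (hinc j).1 (hinc j).2 (hUun j hj)
  -- the split of sums
  have hsplit : ∀ f : Fin m → ℝ, ∑ j, f j = ∑ j ∈ U, f j + ∑ j ∈ R, f j := by
    intro f
    rw [hU, hR]
    exact (Finset.sum_filter_add_sum_filter_not _ _ _).symm
  set M := ∑ j ∈ R, ψ j with hM
  have hUsum : ∑ j ∈ U, ψ j = -M := by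
    have h := hsplit ψ
    rw [hzero] at h
    linarith
  -- both classes are non-empty
  have hRne : R.Nonempty := by
    by_contra hRe
    rw [Finset.not_nonempty_iff_eq_empty] at hRe
    have hM0 : M = 0 := by rw [hM, hRe, Finset.sum_empty]
    have hUuniv : U = Finset.univ := by
      rw [hU, Finset.filter_eq_self]
      intro j _
      by_contra hj
      have : j ∈ R := by rw [hR, mem_filter]; exact ⟨mem_univ _, hj⟩
      rw [hRe] at this; exact absurd this (Finset.notMem_empty _)
    have hneg : ∑ j ∈ U, ψ j < 0 := by
      rw [hUuniv]
      exact Finset.sum_neg (fun j hj => (hUfacts j (hUuniv ▸ hj)).1) ⟨⟨0, hm⟩, mem_univ _⟩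
    rw [hUsum, hM0, neg_zero] at hneg
    exact lt_irrefl 0 hneg
  have hMpos : 0 < M := Finset.sum_pos (fun j hj => (hRfacts j hj).1) hRne
  have hUne : U.Nonempty := by
    by_contra hUe
    rw [Finset.not_nonempty_iff_eq_empty] at hUe
    have : ∑ j ∈ U, ψ j = 0 := by rw [hUe, Finset.sum_empty]
    rw [hUsum] at this
    linarith
  have hρ : (0 : ℝ) < R.card := by exact_mod_cast hRne.card_pos
  have hυ : (0 : ℝ) < U.card := by exact_mod_cast hUne.card_pos
  -- the derivative in closed form
  have hD : (∑ j, ((((e + k + 2 : ℝ) * c j * ((k + 1 : ℝ) * x ^ k)) * (a j + b j * x ^ (e + 1) + c j * x ^ (e + k + 2))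
        - ((e + 1 : ℝ) * b j + (e + k + 2 : ℝ) * c j * x ^ (k + 1))
          * (b j * ((e + 1 : ℝ) * x ^ e) + c j * ((e + k + 2 : ℝ) * x ^ (e + k + 1))))
        / (a j + b j * x ^ (e + 1) + c j * x ^ (e + k + 2)) ^ 2))
      = (e + k + 2 : ℝ) * (k + 1 : ℝ) * x ^ k * (∑ j, c j / G j) - x ^ e * ∑ j, ψ j ^ 2 := by
    rw [Finset.mul_sum, Finset.mul_sum, ← Finset.sum_sub_distrib]
    exact Finset.sum_congr rfl (fun j _ => psi_term_deriv_eq (a j) (b j) (c j) e k (hg j))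
  rw [hD]
  -- bound `A₂`
  have hA : ∑ j, c j / G j ≤ M / ((e + k + 2 : ℝ) * x ^ (k + 1)) := by
    rw [hsplit (fun j => c j / G j), hM, Finset.sum_div]
    have h1 : ∑ j ∈ U, c j / G j ≤ 0 := Finset.sum_nonpos (fun j hj => (hUfacts j hj).2.le)
    have h2 : ∑ j ∈ R, c j / G j ≤ ∑ j ∈ R, ψ j / ((e + k + 2 : ℝ) * x ^ (k + 1)) :=
      Finset.sum_le_sum (fun j hj => (hRfacts j hj).2.1)
    linarith
  -- Cauchy–Schwarz on each class
  have hSR : M ^ 2 ≤ (R.card : ℝ) * ∑ j ∈ R, ψ j ^ 2 := sq_sum_le_card_mul_sum_sq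
  have hSU : M ^ 2 ≤ (U.card : ℝ) * ∑ j ∈ U, ψ j ^ 2 := by
    have h := sq_sum_le_card_mul_sum_sq (s := U) (f := ψ)
    rw [hUsum, neg_sq] at h
    exact h
  have hS : ∑ j, ψ j ^ 2 = ∑ j ∈ U, ψ j ^ 2 + ∑ j ∈ R, ψ j ^ 2 := hsplit (fun j => ψ j ^ 2)
  -- `x^{e+1} M > p |R|`
  have hXM : (e + 1 : ℝ) * R.card < x ^ (e + 1) * M := by
    rw [hM, Finset.mul_sum]
    calc (e + 1 : ℝ) * R.card = ∑ _j ∈ R, (e + 1 : ℝ) := by rw [Finset.sum_const, nsmul_eq_mul, mul_comm]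
      _ < ∑ j ∈ R, x ^ (e + 1) * ψ j := Finset.sum_lt_sum_of_nonempty hRne (fun j hj => (hRfacts j hj).2.2)
  -- assemble: `|R||U|·x·D ≤ M (|R||U|(k+1) − x^{e+1} M m) < 0`
  have hcardm : (U.card : ℝ) + R.card = m := by
    have h := Finset.card_filter_add_card_filter_not (s := (Finset.univ : Finset (Fin m))) (fun j => 0 < a j * G j)
    rw [Finset.card_univ, Fintype.card_fin] at h
    rw [hU, hR]
    exact_mod_cast h
  have hfew' : ((k : ℝ) + 1) * U.card ≤ ((e : ℝ) + 1) * m := hfew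
  have hxk1 : x ^ k * x = x ^ (k + 1) := by rw [pow_succ]
  have hxe1 : x ^ e * x = x ^ (e + 1) := by rw [pow_succ]
  -- Step a: `x·(q(k+1)x^k·A₂) ≤ (k+1)·M`
  have hstepA : x * ((e + k + 2 : ℝ) * (k + 1 : ℝ) * x ^ k * (∑ j, c j / G j)) ≤ (k + 1 : ℝ) * M := by
    have h1 : x * ((e + k + 2 : ℝ) * (k + 1 : ℝ) * x ^ k * (∑ j, c j / G j))
        ≤ x * ((e + k + 2 : ℝ) * (k + 1 : ℝ) * x ^ k * (M / ((e + k + 2 : ℝ) * x ^ (k + 1)))) :=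
      mul_le_mul_of_nonneg_left (mul_le_mul_of_nonneg_left hA (by positivity)) hx.le
    have h2 : x * ((e + k + 2 : ℝ) * (k + 1 : ℝ) * x ^ k * (M / ((e + k + 2 : ℝ) * x ^ (k + 1)))) = (k + 1 : ℝ) * M := by
      rw [← hxk1]
      field_simp
    linarith
  -- Step b: `x^{e+1}·Σψ² > (k+1)·M`
  set S := ∑ j, ψ j ^ 2 with hSdef
  have hb1 : (U.card : ℝ) * M ^ 2 + R.card * M ^ 2 ≤ (R.card : ℝ) * U.card * S := by
    have e1 : (R.card : ℝ) * U.card * S = U.card * (R.card * ∑ j ∈ R, ψ j ^ 2) + R.card * (U.card * ∑ j ∈ U, ψ j ^ 2) := by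
      rw [hS]; ring
    rw [e1]
    exact add_le_add (mul_le_mul_of_nonneg_left hSR hυ.le) (mul_le_mul_of_nonneg_left hSU hρ.le)
  have hm' : (0 : ℝ) < m := by exact_mod_cast hm
  have hb2 : (e + 1 : ℝ) * R.card * m < x ^ (e + 1) * M * m := mul_lt_mul_of_pos_right hXM hm'
  have hb3 : ((k : ℝ) + 1) * U.card * R.card ≤ ((e : ℝ) + 1) * m * R.card := mul_le_mul_of_nonneg_right hfew' hρ.le
  have h4 : x ^ (e + 1) * ((U.card : ℝ) * M ^ 2 + R.card * M ^ 2) ≤ x ^ (e + 1) * ((R.card : ℝ) * U.card * S) :=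
    mul_le_mul_of_nonneg_left hb1 hX.le
  have h5 : x ^ (e + 1) * ((U.card : ℝ) * M ^ 2 + R.card * M ^ 2) = (x ^ (e + 1) * M * m) * M := by
    rw [← hcardm]; ring
  have h6 : ((e + 1 : ℝ) * R.card * m) * M < (x ^ (e + 1) * M * m) * M := mul_lt_mul_of_pos_right hb2 hMpos
  have h7 : (((k : ℝ) + 1) * U.card * R.card) * M ≤ (((e : ℝ) + 1) * m * R.card) * M :=
    mul_le_mul_of_nonneg_right hb3 hMpos.le
  have h8 : (R.card : ℝ) * U.card * ((k + 1 : ℝ) * M) < (R.card : ℝ) * U.card * (x ^ (e + 1) * S) := by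
    have e6 : ((e + 1 : ℝ) * R.card * m) * M = (((e : ℝ) + 1) * m * R.card) * M := by ring
    have e7 : (((k : ℝ) + 1) * U.card * R.card) * M = (R.card : ℝ) * U.card * ((k + 1 : ℝ) * M) := by ring
    have e8 : x ^ (e + 1) * ((R.card : ℝ) * U.card * S) = (R.card : ℝ) * U.card * (x ^ (e + 1) * S) := by ring
    linarith
  have hstepB : (k + 1 : ℝ) * M < x ^ (e + 1) * S := lt_of_mul_lt_mul_left h8 (mul_nonneg hρ.le hυ.le)
  -- conclude: `x·D < 0`
  have hfin : x * ((e + k + 2 : ℝ) * (k + 1 : ℝ) * x ^ k * (∑ j, c j / G j) - x ^ e * S) < 0 := by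
    have e3 : x * ((e + k + 2 : ℝ) * (k + 1 : ℝ) * x ^ k * (∑ j, c j / G j) - x ^ e * S)
        = x * ((e + k + 2 : ℝ) * (k + 1 : ℝ) * x ^ k * (∑ j, c j / G j)) - x ^ (e + 1) * S := by
      rw [← hxe1]; ring
    rw [e3]
    linarith
  by_contra hcon
  push Not at hcon
  exact absurd hfin (not_lt.mpr (mul_nonneg hx.le hcon))

end ProductPlusOne

end Summit.ValiantsHypothesis.ValiantsHypothesis.Theorems.LacunarySymmetroidMatrixDescartes
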